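import Summits.ResolutionOfSingularities.ResolutionOfSingularities.Theorems.WeightedInvariantJOpenPresentationCurve
import HarnessLib

/-!
# (Δ10-e1) THE MODEL-POSITION PACKAGE for input (T) `JOpenLE3.TieFreeAlongCurveLE3` of the (open″)≤3 assembly: along a
# height-two equimultiple stratum `V(𝔭)` through `𝔪`, `A_𝔭` is regular, `0 ≠ F/1 ∈ 𝔪²_{A_𝔭}`, and on a basic open every tie prime
# `𝔮 ⊇ 𝔭` is `> 𝔭` with `(ν ; ε)`-top-stratum prime `𝔭 A_𝔮` (door `HypersurfaceCentreConstruction`, stmt-ResolutionOfSingularities-19897;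
# SPEC (Δ10) rev 2 `L/res-L1-w43-plan-1/TieFreeNearCurve_sketch.lean` d99978ac1e717962 of res-L1-w43-plan-1; DEAL (o52-T-c), hand
# res-D-brk-1)

Topic: `Summits/ResolutionOfSingularities/ResolutionOfSingularities/Theorems`. Helper for the door item
`HypersurfaceCentreConstruction` (stmt-ResolutionOfSingularities-19897, route `WeightedInvariant`), line `local-engine`
(L W4.3), def-free.  The registrar's (Δ10-e) GLUE `tieFreeAlongCurveLE3Spec_of_finite : (Δ10-d) → (Δ10-e1) → (T)` takes two
inputs; this file proves the second, `TieFinite.exists_modelPosition_package`, with the SPEC's signature VERBATIM.  Route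
(= STEPS 0–2 of res-D-brk-1's `JOpenLE3.jOpenPresentationLE_body_curve`, p552753): `A_𝔭 ≃ (A_𝔪)_{𝔭 A_𝔪}` is a localisation of the
regular `A_𝔪`; `hEord` puts `𝔭 A_𝔪` on the equimultiple locus, so `ord_{A_𝔭} F = ord_{A_𝔪} F ≥ 2`; `h₁` is res-type-098's
order-stratum element (`GenericEquimultiplicity.stratumIff_iotaOrd`, p515109) fed by `hEord`; at a tie prime `𝔮 ⊇ 𝔭` with `h₁ ∉ 𝔮`
the equimultiple locus of `A_𝔮` is `V(𝔭 A_𝔮)` (the order iff read at the generizations of `𝔮`), `ε (A_𝔮) F = 0` by the definition of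
a tie position, so the `(ν ; ε)`-top stratum is `V(𝔭 A_𝔮)` too and its generic prime is `𝔭 A_𝔮`; and `𝔭 < 𝔮` because `dim A_𝔮 = 3 ≠ 2`.

[OURS · L1 W4.3 · (o52-T-c)]  Replaces the role of NO printed item; NOT a statement of the manuscript
[claim: Hironaka2017, status: under-review]. AI work, weaker than expert review.  Pure commutative algebra; no named facts.

## References

* V. Cossart, O. Piltant, J. Algebra 320 (2008), Prop. 4.2 (generic behaviour of the order along a regular prime). [CossartPiltant2008]
* H. Matsumura, *Commutative Ring Theory* (1987), Thm. 4.3, Thm. 19.3 (localisations of regular rings). [Matsumura1987]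
* res-L1-w43-plan-1, SPEC (Δ10) rev 2 and REGISTRAR RULING #13 (OURS, AI planning).
-/

noncomputable section

open IsLocalRing Literature.AlgebraicGeometry.Resolution
open Summit.ResolutionOfSingularities.ResolutionOfSingularities.Theorems
open Summit.ResolutionOfSingularities.ResolutionOfSingularities.Theorems.ContactCylinder

set_option linter.dupNamespace false -- mandated namespace of this single-conjunct summit

namespace Summit.ResolutionOfSingularities.ResolutionOfSingularities.Cruxes.HypersurfaceCentreConstruction.LocalEngine

namespace TieFinite

open Iota3

/-- **(Δ10-e1) THE MODEL-POSITION PACKAGE.**  At a model position of (T) — `A` of finite type over a perfect field, primes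
`𝔭 ≤ 𝔪`, `A_𝔪` regular, `0 ≠ F/1 ∈ 𝔪² A_𝔪`, `dim A_𝔭 = 2`, and the equimultiple locus of `A_𝔪` equal to `V(𝔭 A_𝔪)` —: `A_𝔭` is
regular, `0 ≠ F/1 ∈ 𝔪²_{A_𝔭}`, and on some `D(h₁) ∋ 𝔪` every tie prime `𝔮 ⊇ 𝔭` is `> 𝔭` with `(ν ; ε)`-top-stratum prime `𝔭 A_𝔮`
(SPEC (Δ10) rev 2 signature verbatim). [OURS · L1 W4.3 · (o52-T-c)] -/
theorem exists_modelPosition_package (k₀ : Type) [Field k₀] [PerfectField k₀]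
    (A : Type) [CommRing A] [Algebra k₀ A] [Algebra.FiniteType k₀ A] (𝔪 : Ideal A) [𝔪.IsPrime] (F : A)
    (𝔭 : Ideal A) [𝔭.IsPrime] (h𝔭𝔪 : 𝔭 ≤ 𝔪) [IsRegularLocalRing (Localization.AtPrime 𝔪)]
    (hF0 : algebraMap A (Localization.AtPrime 𝔪) F ≠ 0)
    (hF2 : algebraMap A (Localization.AtPrime 𝔪) F ∈ (maximalIdeal (Localization.AtPrime 𝔪)) ^ 2)
    (hdim𝔭 : ringKrullDim (Localization.AtPrime 𝔭) = (2 : ℕ))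
    (hEord : topStratum iotaOrd (Localization.AtPrime 𝔪) (algebraMap A (Localization.AtPrime 𝔪) F) =
      {𝔮 | 𝔭.map (algebraMap A (Localization.AtPrime 𝔪)) ≤ 𝔮.asIdeal}) :
    ∃ (_ : IsRegularLocalRing (Localization.AtPrime 𝔭)),
      algebraMap A (Localization.AtPrime 𝔭) F ≠ 0 ∧
      algebraMap A (Localization.AtPrime 𝔭) F ∈ (maximalIdeal (Localization.AtPrime 𝔭)) ^ 2 ∧
      ∃ h₁ : A, h₁ ∉ 𝔪 ∧ ∀ (𝔮 : Ideal A) [𝔮.IsPrime], h₁ ∉ 𝔮 → 𝔭 ≤ 𝔮 →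
        IsTiePosition (Localization.AtPrime 𝔮) (algebraMap A (Localization.AtPrime 𝔮) F) →
        𝔭 < 𝔮 ∧ topStratumPrime iotaOrdEps (Localization.AtPrime 𝔮) (algebraMap A (Localization.AtPrime 𝔮) F) =
          𝔭.map (algebraMap A (Localization.AtPrime 𝔮)) := by
  classical
  haveI : IsNoetherianRing A := Algebra.FiniteType.isNoetherianRing k₀ A
  haveI := isDomain_of_isRegularLocalRing (Localization.AtPrime 𝔪)
  haveI := isPrime_map_atPrime_of_le 𝔭 𝔪 h𝔭𝔪
  -- `A_𝔭 ≃ (A_𝔪)_{𝔭 A_𝔪}` is regular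
  haveI := isLocalizationAtPrime_atPrime_map 𝔭 𝔪 h𝔭𝔪
  haveI : IsRegularLocalRing (Localization.AtPrime (𝔭.map (algebraMap A (Localization.AtPrime 𝔪)))) :=
    isRegularLocalRing_localization_atPrime (Localization.AtPrime 𝔪) _
  let e : Localization.AtPrime (𝔭.map (algebraMap A (Localization.AtPrime 𝔪))) ≃+* Localization.AtPrime 𝔭 :=
    (IsLocalization.algEquiv 𝔭.primeCompl
      (Localization.AtPrime (𝔭.map (algebraMap A (Localization.AtPrime 𝔪)))) (Localization.AtPrime 𝔭)).toRingEquiv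
  have hreg𝔭 : IsRegularLocalRing (Localization.AtPrime 𝔭) := IsRegularLocalRing.of_ringEquiv e
  haveI := hreg𝔭
  -- `F/1 ≠ 0` at `A_𝔭`
  have hF0𝔭 : algebraMap A (Localization.AtPrime 𝔭) F ≠ 0 := by
    intro h0
    obtain ⟨s, hs⟩ := (IsLocalization.map_eq_zero_iff 𝔭.primeCompl (Localization.AtPrime 𝔭) F).mp h0
    have hs' : algebraMap A (Localization.AtPrime 𝔪) (s : A) * algebraMap A (Localization.AtPrime 𝔪) F = 0 := by
      rw [← map_mul, hs, map_zero]
    rcases mul_eq_zero.mp hs' with h | h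
    · obtain ⟨t, ht⟩ := (IsLocalization.map_eq_zero_iff 𝔪.primeCompl (Localization.AtPrime 𝔪) (s : A)).mp h
      have hts : (t : A) * s ∈ 𝔭 := by rw [ht]; exact Ideal.zero_mem _
      rcases Ideal.IsPrime.mem_or_mem ‹𝔭.IsPrime› hts with h' | h'
      · exact t.2 (h𝔭𝔪 h')
      · exact s.2 h'
    · exact hF0 h
  -- the order at `A_𝔭` is the order at `A_𝔪`, `≥ 2`
  have h2 : (2 : Ordinal) ≤ iotaOrd (Localization.AtPrime 𝔪) (algebraMap A (Localization.AtPrime 𝔪) F) :=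
    (StratumIff.mem_sq_iff_two_le_iotaOrd F 𝔪).mp hF2
  have hord𝔭 : iotaOrd (Localization.AtPrime 𝔭) (algebraMap A (Localization.AtPrime 𝔭) F) =
      iotaOrd (Localization.AtPrime 𝔪) (algebraMap A (Localization.AtPrime 𝔪) F) := by
    have h := Set.ext_iff.mp hEord ⟨𝔭.map (algebraMap A (Localization.AtPrime 𝔪)), inferInstance⟩
    rw [ContactCylinder.mem_topStratum_iff, Set.mem_setOf_eq] at h
    rw [← h.mpr le_rfl, StratumIff.iota_localization_localization_eq iotaOrd iotaOrd_isoInvariant 𝔪 _ F,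
      StratumIff.iota_localization_congr iotaOrd (comap_map_atPrime_of_le 𝔭 𝔪 h𝔭𝔪) F]
  have hF2𝔭 : algebraMap A (Localization.AtPrime 𝔭) F ∈ maximalIdeal (Localization.AtPrime 𝔭) ^ 2 := by
    rw [StratumIff.mem_sq_iff_two_le_iotaOrd, hord𝔭]; exact h2
  -- the ORDER stratum iff on a basic open `D(h₁) ∋ 𝔪` (res-type-098), fed by `hEord`
  have hf : algebraMap A (Localization.AtPrime 𝔪) F ∈ maximalIdeal (Localization.AtPrime 𝔪) := Ideal.pow_le_self two_ne_zero hF2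
  have hstrat : ∀ (𝔭' : Ideal (Localization.AtPrime 𝔪)) [𝔭'.IsPrime],
      algebraMap A (Localization.AtPrime 𝔪) F ∈ 𝔭' →
        (iotaOrd (Localization.AtPrime 𝔭') (algebraMap (Localization.AtPrime 𝔪) (Localization.AtPrime 𝔭')
            (algebraMap A (Localization.AtPrime 𝔪) F)) =
          iotaOrd (Localization.AtPrime 𝔪) (algebraMap A (Localization.AtPrime 𝔪) F) ↔
            𝔭.map (algebraMap A (Localization.AtPrime 𝔪)) ≤ 𝔭') := by
    intro 𝔭' _ _
    have h := Set.ext_iff.mp hEord ⟨𝔭', inferInstance⟩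
    rwa [ContactCylinder.mem_topStratum_iff, Set.mem_setOf_eq] at h
  have hadm : ∀ (Q : Ideal (Localization.AtPrime 𝔪)) [Q.IsPrime], 𝔭.map (algebraMap A (Localization.AtPrime 𝔪)) ≤ Q →
      algebraMap (Localization.AtPrime 𝔪) (Localization.AtPrime Q) (algebraMap A (Localization.AtPrime 𝔪) F) ∈
        maximalIdeal (Localization.AtPrime Q) ^ 2 := by
    intro Q _ hQ
    have h := Set.ext_iff.mp hEord ⟨Q, inferInstance⟩
    rw [ContactCylinder.mem_topStratum_iff, Set.mem_setOf_eq] at h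
    rw [StratumIff.mem_sq_localization_localization_iff 𝔪 Q F, StratumIff.mem_sq_iff_two_le_iotaOrd,
      ← StratumIff.iota_localization_localization_eq iotaOrd iotaOrd_isoInvariant 𝔪 Q F, h.mpr hQ]
    exact h2
  obtain ⟨h₁, hh₁, hiff⟩ := GenericEquimultiplicity.stratumIff_iotaOrd k₀ 𝔪 F ‹_› hF0
    (𝔭.map (algebraMap A (Localization.AtPrime 𝔪))) (fun 𝔭' _ hF => hstrat 𝔭' hF) hadm
  rw [comap_map_atPrime_of_le 𝔭 𝔪 h𝔭𝔪] at hiff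
  have hsq : ∀ (𝔮 : Ideal A) [𝔮.IsPrime], h₁ ∉ 𝔮 →
      iotaOrd (Localization.AtPrime 𝔮) (algebraMap A (Localization.AtPrime 𝔮) F) =
          iotaOrd (Localization.AtPrime 𝔪) (algebraMap A (Localization.AtPrime 𝔪) F) →
        algebraMap A (Localization.AtPrime 𝔮) F ∈ maximalIdeal (Localization.AtPrime 𝔮) ^ 2 := by
    intro 𝔮 _ _ heq
    rw [StratumIff.mem_sq_iff_two_le_iotaOrd, heq]
    exact h2
  refine ⟨hreg𝔭, hF0𝔭, hF2𝔭, h₁, hh₁, fun 𝔮 _ hh₁𝔮 h𝔭𝔮 htie => ⟨?_, ?_⟩⟩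
  · -- `𝔭 < 𝔮`: a tie position has dimension `3 ≠ 2`
    refine lt_of_le_of_ne h𝔭𝔮 fun heq => ?_
    subst heq
    have h3 := ringKrullDim_eq_three_of_isTiePosition htie
    rw [hdim𝔭] at h3
    exact absurd h3 (by norm_cast)
  · -- the `(ν ; ε)`-top stratum of `A_𝔮` is the equimultiple locus `V(𝔭 A_𝔮)` (`ε = 0` at a tie)
    haveI := htie.isRegularLocalRing
    haveI := isPrime_map_atPrime_of_le 𝔭 𝔮 h𝔭𝔮
    have hE𝔮 := topStratum_atPrime_eq_of_stratumIff iotaOrd iotaOrd_isoInvariant 𝔪 𝔭 F hiff hsq 𝔮 h𝔭𝔮 hh₁𝔮 hh₁𝔮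
    have hf𝔮 : algebraMap A (Localization.AtPrime 𝔮) F ∈ maximalIdeal (Localization.AtPrime 𝔮) := htie.mem_maximalIdeal
    refine topStratumPrime_eq_of_topStratum_eq iotaOrdEps _ _ ?_
    rw [topStratum_iotaOrdEps_eq_topStratum_iotaOrd_of_iotaEps_eq_zero hf𝔮 htie.2.2.1]
    exact hE𝔮

end TieFinite

end Summit.ResolutionOfSingularities.ResolutionOfSingularities.Cruxes.HypersurfaceCentreConstruction.LocalEngine

end
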